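import Mathlib
import Summits.ABC.ABC.Theses.IneffectiveSubspace

/-!
# Stub `stub_abcGivesUL` of line `SketchIdeator5` (idea `cm-hall-lang-transfer`) — crux `IneffectiveSubspace.TowerFourSubLiouville` (stmt-ABC-1649)

CERTIFICATE (not a hypothesis of the composition): `ABC ⟹ UNIFORM LJUNGGREN`, i.e. under the abc
conjecture there are reals `K` and `C > 0` such that every integer solution of `x² − d·y⁴ = k`
(`d` not a square, `k ≠ 0`) has `|y| ≤ C·(|d|·|k|)^K`.  We obtain `K = 7`, `C = 3·max(C₀, 1)³`,
where `C₀` is the abc constant at `ε = 1/5`.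

Proof.  Put `D = |d| ≥ 1`, `κ = |k| ≥ 1`, `X = |x|`, `Y = |y|` (naturals).  According to the signs
of `d, k` the equation reads `D·Y⁴ + κ = X²`, `X² + κ = D·Y⁴` or `X² + D·Y⁴ = κ` (`d, k < 0` is
impossible).  The third shape is trivial (`Y ≤ Y⁴ ≤ κ`).  In the first two, `a + b = c` with
`b = κ`, `c ≥ D·Y⁴` and `abc = X²·κ·(D·Y⁴)`; dividing out `g = gcd(a, b) ≤ κ` gives an abc triple
`a' + b' = c'` with `c = g·c'` and `rad(a'b'c') ∣ rad(abc) ∣ P := X·κ·(D·Y)`, so abc at `ε = 1/5`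
gives `D·Y⁴ ≤ c ≤ κ·c' < κ·C₀·P^{6/5}`.  Fifth powers and `X² ≤ D·Y⁴ + κ ≤ 2DκY⁴` give
`D⁵Y²⁰ < κ⁵C₀⁵·P⁶ ≤ κ⁵C₀⁵·8D⁹κ⁹Y¹⁸`, hence `Y² < 8C₀⁵κ¹⁴D⁴ < 9·max(C₀,1)⁶·(Dκ)¹⁴` and
`Y < 3·max(C₀,1)³·(Dκ)⁷`.  (The gcd-removal step follows the pattern of
`Negative.Framing.cube_lt_of_abc`.)
-/

-- `Summit.ABC.ABC` is the mandated summit-side namespace (CONVENTIONS §2); the duplicate is deliberate.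
set_option linter.dupNamespace false

namespace Summit.ABC.ABC.Theorems.TowerFourSubLiouville

open Literature.NumberTheory.DiophantineGeometry (IsABCTriple rad rad_def)
open UniqueFactorizationMonoid (radical radical_mul_dvd radical_pow_dvd radical_dvd_self
  radical_dvd_radical)

/-- `rad(X²·κ·(D·Y⁴)) ∣ X·κ·(D·Y)` (`radical_mul_dvd`, `radical_pow_dvd`, `radical_dvd_self`). -/
theorem abcGivesUL_radical_dvd (X Kk D Yn : ℕ) :
    radical (X ^ 2 * Kk * (D * Yn ^ 4)) ∣ X * Kk * (D * Yn) :=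
  calc radical (X ^ 2 * Kk * (D * Yn ^ 4))
      ∣ radical (X ^ 2 * Kk) * radical (D * Yn ^ 4) := radical_mul_dvd
    _ ∣ (radical (X ^ 2) * radical Kk) * (radical D * radical (Yn ^ 4)) :=
        mul_dvd_mul radical_mul_dvd radical_mul_dvd
    _ ∣ (X * Kk) * (D * Yn) :=
        mul_dvd_mul (mul_dvd_mul (radical_pow_dvd.trans radical_dvd_self) radical_dvd_self)
          (mul_dvd_mul radical_dvd_self (radical_pow_dvd.trans radical_dvd_self))

/-- abc applied to a NOT necessarily coprime `a + b = c` (`a, b > 0`): with `g = gcd(a, b) ≤ b`,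
`c = g·c'`, `a' + b' = c'` an abc triple and `rad(a'b'c') ∣ rad(abc) ∣ P`, the abc inequality
`c' < C₀·rad(a'b'c')^{1+e}` gives `c < b·C₀·P^{1+e}` (pattern of `Negative.cube_lt_of_abc`). -/
theorem abcGivesUL_lt_of_abc {C₀ e : ℝ} (hC₀ : 0 < C₀) (he : 0 ≤ e)
    (hABC : ∀ a b c : ℕ, IsABCTriple a b c → (c : ℝ) < C₀ * (rad a b c : ℝ) ^ (1 + e))
    {a b c P : ℕ} (ha : 0 < a) (hb : 0 < b) (hc : a + b = c) (hP0 : 0 < P)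
    (hrad : radical (a * b * c) ∣ P) :
    (c : ℝ) < b * C₀ * (P : ℝ) ^ (1 + e) := by
  set g := Nat.gcd a b
  have hg0 : 0 < g := Nat.gcd_pos_of_pos_left _ ha
  obtain ⟨a', ha'⟩ : ∃ a', a = g * a' := Nat.gcd_dvd_left a b
  obtain ⟨b', hb'⟩ : ∃ b', b = g * b' := Nat.gcd_dvd_right a b
  have ha'0 : 0 < a' := by
    rcases Nat.eq_zero_or_pos a' with h0 | h0
    · rw [h0, mul_zero] at ha'; omega
    · exact h0
  have hb'0 : 0 < b' := by
    rcases Nat.eq_zero_or_pos b' with h0 | h0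
    · rw [h0, mul_zero] at hb'; omega
    · exact h0
  have hcop : Nat.Coprime a' b' := by
    have h1 : a' = a / g := by rw [ha', Nat.mul_div_cancel_left _ hg0]
    have h2 : b' = b / g := by rw [hb', Nat.mul_div_cancel_left _ hg0]
    rw [h1, h2]; exact Nat.coprime_div_gcd_div_gcd hg0
  have hc' : c = g * (a' + b') := by rw [← hc, ha', hb']; ring
  have htriple : IsABCTriple a' b' (a' + b') := ⟨ha'0, hb'0, rfl, hcop⟩
  have hlt := hABC _ _ _ htriple
  have hc0 : 0 < c := hc ▸ Nat.add_pos_left ha b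
  have habc0 : a * b * c ≠ 0 := (Nat.mul_pos (Nat.mul_pos ha hb) hc0).ne'
  have hdvd' : a' * b' * (a' + b') ∣ a * b * c :=
    mul_dvd_mul (mul_dvd_mul (Dvd.intro_left _ ha'.symm) (Dvd.intro_left _ hb'.symm))
      (Dvd.intro_left _ hc'.symm)
  have hradle : (rad a' b' (a' + b') : ℝ) ≤ P := by
    have h1 : rad a' b' (a' + b') ∣ P := by
      rw [rad_def]
      exact (radical_dvd_radical hdvd' habc0).trans hrad
    exact_mod_cast Nat.le_of_dvd hP0 h1
  have hc'lt : ((a' + b' : ℕ) : ℝ) < C₀ * (P : ℝ) ^ (1 + e) := by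
    calc ((a' + b' : ℕ) : ℝ) < C₀ * (rad a' b' (a' + b') : ℝ) ^ (1 + e) := hlt
      _ ≤ C₀ * (P : ℝ) ^ (1 + e) := by
          apply mul_le_mul_of_nonneg_left _ hC₀.le
          exact Real.rpow_le_rpow (by positivity) hradle (by linarith)
  have hgb : (g : ℝ) ≤ b := by exact_mod_cast Nat.le_of_dvd hb (Nat.gcd_dvd_right a b)
  have hcn : (0 : ℝ) ≤ ((a' + b' : ℕ) : ℝ) := by positivity
  have hb0 : (0 : ℝ) < b := by exact_mod_cast hb
  calc (c : ℝ) = (g : ℝ) * ((a' + b' : ℕ) : ℝ) := by rw [hc']; push_cast; ring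
    _ ≤ (b : ℝ) * ((a' + b' : ℕ) : ℝ) := mul_le_mul_of_nonneg_right hgb hcn
    _ < (b : ℝ) * (C₀ * (P : ℝ) ^ (1 + e)) := mul_lt_mul_of_pos_left hc'lt hb0
    _ = b * C₀ * (P : ℝ) ^ (1 + e) := by ring

/-- The numerical heart: from `X² ≤ D·Y⁴ + κ` and `D·Y⁴ < κ·C₀·(X·κ·(D·Y))^{6/5}` (`D, κ, Y ≥ 1`)
to `Y < 3·max(C₀,1)³·(Dκ)⁷` (fifth powers; `P⁶ ≤ 8D⁹κ⁹Y¹⁸`). -/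
theorem abcGivesUL_estimate {C₀ : ℝ} (hC₀ : 0 < C₀) {D Kk X Yn : ℕ} (hD : 0 < D) (hK : 0 < Kk)
    (hY : 0 < Yn) (hX : X ^ 2 ≤ D * Yn ^ 4 + Kk)
    (hlt : ((D * Yn ^ 4 : ℕ) : ℝ) <
      Kk * C₀ * ((X * Kk * (D * Yn) : ℕ) : ℝ) ^ ((1 : ℝ) + 1 / 5)) :
    (Yn : ℝ) < 3 * (max C₀ 1) ^ 3 * ((D * Kk : ℕ) : ℝ) ^ 7 := by
  have hD1 : (1 : ℝ) ≤ D := by exact_mod_cast hD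
  have hK1 : (1 : ℝ) ≤ Kk := by exact_mod_cast hK
  have hY1 : (1 : ℝ) ≤ Yn := by exact_mod_cast hY
  -- `X² ≤ 2DκY⁴`
  have hX' : (X : ℝ) ^ 2 ≤ 2 * D * Kk * (Yn : ℝ) ^ 4 := by
    have h1 : (X : ℝ) ^ 2 ≤ D * (Yn : ℝ) ^ 4 + Kk := by exact_mod_cast hX
    have hY4 : (1 : ℝ) ≤ (Yn : ℝ) ^ 4 := one_le_pow₀ hY1
    have hDY : (1 : ℝ) ≤ D * (Yn : ℝ) ^ 4 := one_le_mul_of_one_le_of_one_le hD1 hY4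
    have h2 : (D : ℝ) * (Yn : ℝ) ^ 4 ≤ D * (Yn : ℝ) ^ 4 * Kk :=
      le_mul_of_one_le_right (by positivity) hK1
    have h3 : (Kk : ℝ) ≤ D * (Yn : ℝ) ^ 4 * Kk := le_mul_of_one_le_left (by positivity) hDY
    linarith
  have hP0 : (0 : ℝ) ≤ (X : ℝ) * Kk * (D * Yn) := by positivity
  -- the abc inequality, in real form, raised to the fifth power
  have hlt' : (D : ℝ) * (Yn : ℝ) ^ 4 < Kk * C₀ * ((X : ℝ) * Kk * (D * Yn)) ^ ((6 : ℝ) / 5) := by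
    have h := hlt
    rw [show (1 : ℝ) + 1 / 5 = 6 / 5 by norm_num] at h
    push_cast at h
    exact h
  have h5 : ((D : ℝ) * (Yn : ℝ) ^ 4) ^ 5 <
      ((Kk : ℝ) * C₀ * ((X : ℝ) * Kk * (D * Yn)) ^ ((6 : ℝ) / 5)) ^ 5 :=
    pow_lt_pow_left₀ hlt' (by positivity) (by norm_num)
  have hrpow : (((X : ℝ) * Kk * (D * Yn)) ^ ((6 : ℝ) / 5)) ^ 5 = ((X : ℝ) * Kk * (D * Yn)) ^ 6 := by
    rw [← Real.rpow_natCast _ 5, ← Real.rpow_mul hP0, ← Real.rpow_natCast _ 6]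
    norm_num
  -- `P⁶ ≤ 8D⁹κ⁹Y¹⁸`
  have hP6 : ((X : ℝ) * Kk * (D * Yn)) ^ 6 ≤ 8 * (D : ℝ) ^ 9 * (Kk : ℝ) ^ 9 * (Yn : ℝ) ^ 18 := by
    have hX3 : ((X : ℝ) ^ 2) ^ 3 ≤ (2 * D * Kk * (Yn : ℝ) ^ 4) ^ 3 :=
      pow_le_pow_left₀ (by positivity) hX' 3
    have hrest : (0 : ℝ) ≤ (Kk : ℝ) ^ 6 * ((D : ℝ) * Yn) ^ 6 := by positivity
    calc ((X : ℝ) * Kk * (D * Yn)) ^ 6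
        = ((X : ℝ) ^ 2) ^ 3 * ((Kk : ℝ) ^ 6 * ((D : ℝ) * Yn) ^ 6) := by ring
      _ ≤ (2 * D * Kk * (Yn : ℝ) ^ 4) ^ 3 * ((Kk : ℝ) ^ 6 * ((D : ℝ) * Yn) ^ 6) :=
          mul_le_mul_of_nonneg_right hX3 hrest
      _ = 8 * (D : ℝ) ^ 9 * (Kk : ℝ) ^ 9 * (Yn : ℝ) ^ 18 := by ring
  -- `Y²·(D⁵Y¹⁸) = (DY⁴)⁵ < κ⁵C₀⁵P⁶ ≤ (8C₀⁵κ¹⁴D⁴)·(D⁵Y¹⁸)`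
  have hmain : (Yn : ℝ) ^ 2 * ((D : ℝ) ^ 5 * (Yn : ℝ) ^ 18) <
      (8 * C₀ ^ 5 * (Kk : ℝ) ^ 14 * (D : ℝ) ^ 4) * ((D : ℝ) ^ 5 * (Yn : ℝ) ^ 18) := by
    calc (Yn : ℝ) ^ 2 * ((D : ℝ) ^ 5 * (Yn : ℝ) ^ 18) = ((D : ℝ) * (Yn : ℝ) ^ 4) ^ 5 := by ring
      _ < ((Kk : ℝ) * C₀ * ((X : ℝ) * Kk * (D * Yn)) ^ ((6 : ℝ) / 5)) ^ 5 := h5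
      _ = (Kk : ℝ) ^ 5 * C₀ ^ 5 * ((X : ℝ) * Kk * (D * Yn)) ^ 6 := by rw [mul_pow, mul_pow, hrpow]
      _ ≤ (Kk : ℝ) ^ 5 * C₀ ^ 5 * (8 * (D : ℝ) ^ 9 * (Kk : ℝ) ^ 9 * (Yn : ℝ) ^ 18) :=
          mul_le_mul_of_nonneg_left hP6 (by positivity)
      _ = (8 * C₀ ^ 5 * (Kk : ℝ) ^ 14 * (D : ℝ) ^ 4) * ((D : ℝ) ^ 5 * (Yn : ℝ) ^ 18) := by ring
  have hY2 : (Yn : ℝ) ^ 2 < 8 * C₀ ^ 5 * (Kk : ℝ) ^ 14 * (D : ℝ) ^ 4 :=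
    lt_of_mul_lt_mul_right hmain (by positivity)
  -- compare with `(3·C₁³·(Dκ)⁷)² = 9·C₁⁶·(Dκ)¹⁴`, `C₁ = max C₀ 1`
  have hC₁1 : (1 : ℝ) ≤ max C₀ 1 := le_max_right _ _
  have hC₀₁ : C₀ ≤ max C₀ 1 := le_max_left _ _
  have hC5 : C₀ ^ 5 ≤ (max C₀ 1) ^ 6 :=
    calc C₀ ^ 5 ≤ (max C₀ 1) ^ 5 := pow_le_pow_left₀ hC₀.le hC₀₁ 5
      _ ≤ (max C₀ 1) ^ 6 := pow_le_pow_right₀ hC₁1 (by norm_num)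
  have hD4 : (D : ℝ) ^ 4 ≤ (D : ℝ) ^ 14 := pow_le_pow_right₀ hD1 (by norm_num)
  have hbound : 8 * C₀ ^ 5 * (Kk : ℝ) ^ 14 * (D : ℝ) ^ 4 <
      (3 * (max C₀ 1) ^ 3 * ((D * Kk : ℕ) : ℝ) ^ 7) ^ 2 := by
    have hDK : (3 * (max C₀ 1) ^ 3 * ((D * Kk : ℕ) : ℝ) ^ 7) ^ 2 =
        9 * (max C₀ 1) ^ 6 * ((Kk : ℝ) ^ 14 * (D : ℝ) ^ 14) := by
      push_cast; ring
    rw [hDK]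
    have h1 : C₀ ^ 5 * ((Kk : ℝ) ^ 14 * (D : ℝ) ^ 4) ≤ (max C₀ 1) ^ 6 * ((Kk : ℝ) ^ 14 * (D : ℝ) ^ 14) :=
      mul_le_mul hC5 (mul_le_mul_of_nonneg_left hD4 (by positivity)) (by positivity) (by positivity)
    have h2 : (0 : ℝ) < (max C₀ 1) ^ 6 * ((Kk : ℝ) ^ 14 * (D : ℝ) ^ 14) := by positivity
    linarith
  exact lt_of_pow_lt_pow_left₀ 2 (by positivity) (hY2.trans hbound)

/-- The trivial corner: `Y ≤ D·κ` already gives the bound (`3·max(C₀,1)³ ≥ 1`, `Dκ ≤ (Dκ)⁷`). -/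
theorem abcGivesUL_trivial {C₀ : ℝ} {D Kk Yn : ℕ} (hD : 0 < D) (hK : 0 < Kk) (hYle : Yn ≤ D * Kk) :
    (Yn : ℝ) ≤ 3 * (max C₀ 1) ^ 3 * ((D * Kk : ℕ) : ℝ) ^ 7 := by
  have h1 : (1 : ℝ) ≤ ((D * Kk : ℕ) : ℝ) := Nat.one_le_cast.mpr (Nat.mul_pos hD hK)
  have h2 : (Yn : ℝ) ≤ ((D * Kk : ℕ) : ℝ) := by exact_mod_cast hYle
  have h3 : ((D * Kk : ℕ) : ℝ) ≤ ((D * Kk : ℕ) : ℝ) ^ 7 := le_self_pow₀ h1 (by norm_num)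
  have hC : (1 : ℝ) ≤ 3 * (max C₀ 1) ^ 3 := by
    have : (1 : ℝ) ≤ max C₀ 1 := le_max_right _ _
    nlinarith [one_le_pow₀ (n := 3) this]
  calc (Yn : ℝ) ≤ ((D * Kk : ℕ) : ℝ) ^ 7 := h2.trans h3
    _ = 1 * ((D * Kk : ℕ) : ℝ) ^ 7 := (one_mul _).symm
    _ ≤ 3 * (max C₀ 1) ^ 3 * ((D * Kk : ℕ) : ℝ) ^ 7 := mul_le_mul_of_nonneg_right hC (by positivity)

/-- Core over `ℕ`: each of the three sign shapes of `x² − d·y⁴ = k` (`D = |d| ≥ 1`, `κ = |k| ≥ 1`)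
forces `Y ≤ 3·max(C₀,1)³·(Dκ)⁷`, given abc at `ε = 1/5` with constant `C₀`. -/
theorem abcGivesUL_core {C₀ : ℝ} (hC₀ : 0 < C₀)
    (hABC : ∀ a b c : ℕ, IsABCTriple a b c → (c : ℝ) < C₀ * (rad a b c : ℝ) ^ ((1 : ℝ) + 1 / 5))
    {D Kk X Yn : ℕ} (hD : 0 < D) (hK : 0 < Kk)
    (hcase : D * Yn ^ 4 + Kk = X ^ 2 ∨ X ^ 2 + Kk = D * Yn ^ 4 ∨ X ^ 2 + D * Yn ^ 4 = Kk) :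
    (Yn : ℝ) ≤ 3 * (max C₀ 1) ^ 3 * ((D * Kk : ℕ) : ℝ) ^ 7 := by
  rcases Nat.eq_zero_or_pos Yn with hY0 | hY
  · subst hY0
    rw [Nat.cast_zero]
    positivity
  rcases hcase with h1 | h2 | h3
  · -- shape `D·Y⁴ + κ = X²`: abc for `a = D·Y⁴`, `b = κ`, `c = X²`
    have hX2 : 0 < X ^ 2 := by rw [← h1]; positivity
    have hX0 : 0 < X := Nat.pos_of_ne_zero fun h0 => by simp [h0] at hX2
    have hP0 : 0 < X * Kk * (D * Yn) := Nat.mul_pos (Nat.mul_pos hX0 hK) (Nat.mul_pos hD hY)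
    have ha : 0 < D * Yn ^ 4 := Nat.mul_pos hD (pow_pos hY 4)
    have hrad : radical (D * Yn ^ 4 * Kk * X ^ 2) ∣ X * Kk * (D * Yn) := by
      rw [show D * Yn ^ 4 * Kk * X ^ 2 = X ^ 2 * Kk * (D * Yn ^ 4) by ring]
      exact abcGivesUL_radical_dvd X Kk D Yn
    have hlt := abcGivesUL_lt_of_abc hC₀ (by norm_num) hABC ha hK h1 hP0 hrad
    have hle : ((D * Yn ^ 4 : ℕ) : ℝ) ≤ ((X ^ 2 : ℕ) : ℝ) :=
      Nat.cast_le.mpr ((Nat.le_add_right _ _).trans_eq h1)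
    exact (abcGivesUL_estimate hC₀ hD hK hY h1.ge (hle.trans_lt hlt)).le
  · -- shape `X² + κ = D·Y⁴`: abc for `a = X²`, `b = κ`, `c = D·Y⁴` (unless `X = 0`)
    rcases Nat.eq_zero_or_pos X with hX0 | hX0
    · apply abcGivesUL_trivial hD hK
      have hKk : Kk = D * Yn ^ 4 := by simpa [hX0] using h2
      calc Yn ≤ Yn ^ 4 := Nat.le_self_pow (by norm_num) Yn
        _ ≤ D * Yn ^ 4 := Nat.le_mul_of_pos_left _ hD
        _ = Kk := hKk.symm
        _ ≤ D * Kk := Nat.le_mul_of_pos_left _ hD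
    · have hP0 : 0 < X * Kk * (D * Yn) := Nat.mul_pos (Nat.mul_pos hX0 hK) (Nat.mul_pos hD hY)
      have hlt := abcGivesUL_lt_of_abc hC₀ (by norm_num) hABC (pow_pos hX0 2) hK h2 hP0
        (abcGivesUL_radical_dvd X Kk D Yn)
      have hXle : X ^ 2 ≤ D * Yn ^ 4 + Kk :=
        ((Nat.le_add_right _ _).trans_eq h2).trans (Nat.le_add_right _ _)
      exact (abcGivesUL_estimate hC₀ hD hK hY hXle hlt).le
  · -- shape `X² + D·Y⁴ = κ`: trivial
    apply abcGivesUL_trivial hD hK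
    calc Yn ≤ Yn ^ 4 := Nat.le_self_pow (by norm_num) Yn
      _ ≤ D * Yn ^ 4 := Nat.le_mul_of_pos_left _ hD
      _ ≤ X ^ 2 + D * Yn ^ 4 := Nat.le_add_left _ _
      _ = Kk := h3
      _ ≤ D * Kk := Nat.le_mul_of_pos_left _ hD

/-- Certificate, registered form (= def `AbcGivesUL`, unfolded): **`ABC ⟹ UNIFORM LJUNGGREN`**, with
`K = 7` and `C = 3·max(C₀,1)³`, `C₀` the abc constant at `ε = 1/5`. -/
theorem stub_abcGivesUL : _root_.ABC → ∃ K C : ℝ, 0 < C ∧ ∀ d k x y : ℤ, ¬ IsSquare d → k ≠ 0 → x ^ 2 - d * y ^ 4 = k → (|y| : ℝ) ≤ C * ((|d| * |k| : ℤ) : ℝ) ^ K := by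
  intro habc
  obtain ⟨C₀, hC₀, hABC⟩ := (ABC_iff.mp habc) (1 / 5) (by norm_num)
  refine ⟨7, 3 * (max C₀ 1) ^ 3, by positivity, fun d k x y hd hk h => ?_⟩
  have hd0 : d ≠ 0 := by
    rintro rfl
    exact hd ⟨0, by simp⟩
  -- move the goal to `ℕ`
  have hgoal : (|y| : ℝ) = (y.natAbs : ℝ) := by rw [Nat.cast_natAbs, Int.cast_abs]
  have hdk : ((|d| * |k| : ℤ) : ℝ) = ((d.natAbs * k.natAbs : ℕ) : ℝ) := by
    rw [Int.cast_mul, Int.cast_abs, Int.cast_abs, Nat.cast_mul, Nat.cast_natAbs, Nat.cast_natAbs,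
      Int.cast_abs, Int.cast_abs]
  rw [hgoal, hdk, Real.rpow_ofNat]
  refine abcGivesUL_core hC₀ hABC (X := x.natAbs) (Int.natAbs_pos.mpr hd0) (Int.natAbs_pos.mpr hk) ?_
  -- the three sign shapes
  rcases lt_trichotomy 0 d with hdpos | hd0' | hdneg
  · rcases lt_trichotomy 0 k with hkpos | hk0 | hkneg
    · -- `d > 0`, `k > 0`: `D·Y⁴ + κ = X²`
      left
      have e : x ^ 2 = d * y ^ 4 + k := by linear_combination h
      have h' := congrArg Int.natAbs e
      rw [Int.natAbs_add_of_nonneg (mul_nonneg hdpos.le (by positivity)) hkpos.le] at h'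
      simp only [Int.natAbs_pow, Int.natAbs_mul] at h'
      exact h'.symm
    · exact absurd hk0.symm hk
    · -- `d > 0`, `k < 0`: `X² + κ = D·Y⁴`
      right; left
      have e : x ^ 2 + -k = d * y ^ 4 := by linear_combination h
      have h' := congrArg Int.natAbs e
      rw [Int.natAbs_add_of_nonneg (by positivity) (by linarith)] at h'
      simp only [Int.natAbs_pow, Int.natAbs_mul, Int.natAbs_neg] at h'
      exact h'
  · exact absurd hd0'.symm hd0
  · rcases lt_or_gt_of_ne hk with hkneg | hkpos
    · -- `d < 0`, `k < 0`: impossible (`x² − d y⁴ ≥ 0`)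
      exfalso
      have h1 : (0 : ℤ) ≤ x ^ 2 := sq_nonneg x
      have h2 : (0 : ℤ) ≤ -d * y ^ 4 := mul_nonneg (by linarith) (by positivity)
      linarith
    · -- `d < 0`, `k > 0`: `X² + D·Y⁴ = κ`
      right; right
      have e : x ^ 2 + -d * y ^ 4 = k := by linear_combination h
      have h' := congrArg Int.natAbs e
      rw [Int.natAbs_add_of_nonneg (by positivity) (mul_nonneg (by linarith) (by positivity))] at h'
      simp only [Int.natAbs_pow, Int.natAbs_mul, Int.natAbs_neg] at h'
      exact h'

end Summit.ABC.ABC.Theorems.TowerFourSubLiouville
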